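import Mathlib
import HarnessLib
import Literature.Combinatorics.AssociationSchemes.Basic
import Summits.MatrixMultiplication.MatrixMultiplication.Theses.CommutativeSchemes
import Summits.MatrixMultiplication.MatrixMultiplication.Theorems.CommutativeSchemesCommutativeRealizationStubCommutativeRealizationCube
import Summits.MatrixMultiplication.MatrixMultiplication.Theorems.CommutativeSchemesCommutativeRealizationStubConjugacyScheme

/-!
# Crux `CommutativeRealization` (stmt-MatrixMultiplication-9462) — `Lines/conjugacy.lean`, an ALTERNATIVE line
(crux-strategist, registered with `--alt`; it does not touch the live skeleton `Lines/birth.lean`)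

Route `CommutativeSchemes` (route-MatrixMultiplication-CommutativeSchemes; deciding theorem
`closes : CommutativeRealization → RealizationSRank → WeightRemoval → MatrixMultiplication`, with
`RealizationSRank`, `WeightRemoval` proved): the crux is Cohn–Umans 2013 Conjecture 21 in ε-form — for every
`ε > 0` some COMMUTATIVE association scheme with at most `n^(2+ε)` classes realises `⟨n,n,n⟩` (`n ≥ 2`).

THE LINE = GROUP ASSOCIATION SCHEMES (Cohn–Umans 2013 §6.3, the paper's SECOND host family): for ANY finite
group `G` — abelian or not — the Schurian scheme of `G × G` acting on `G` by `(u,v)·g = u g v⁻¹` is a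
COMMUTATIVE association scheme whose classes are the conjugacy classes of `G`
(`cls x y = conjugacy class of x⁻¹ y`, rank `k(G)` = number of conjugacy classes; CU13 §6.3: "This gives rise
to a commutative coherent configuration (regardless of whether G is commutative or not, which is attractive
for our application)"). Realisation of `⟨l,m,n⟩` in it is a TWO-SIDED ("conjugacy-twisted") triple product
property of three subsets `A, B, C ⊆ G` (CU13 Prop. 14 for this action): for `a,a' ∈ A`, `b,b' ∈ B`,
`c,c' ∈ C` and `g,h ∈ G`, `(a⁻¹b') · g(b⁻¹c')g⁻¹ · h(c⁻¹a')h⁻¹ = 1 ⟹ a = a', b = b', c = c'`, and the price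
is `k(G)` — NOT `|G|` and NOT `Σ d_i^ω`: all character degrees of a commutative scheme are `1`. CU13 Thm. 24 +
Lemma 25 + Cor. 26: the wreath products `S_n ⋉ H^n` over abelian STPP families give group association schemes
proving `ω_s ≤ 2.41`, and either conjecture of CKSU05 makes them prove `ω_s = 2`; so this host family has
exactly the standing of the translation family of line `birth` (CU13 Thm. 20 / §6.2), with a disjoint toolbox.

* `stub_conjugacyClassDesign` — THE LOAD-BEARING OPEN STUB (XL): for every `ε > 0` a finite group `G` and a
  shape `l·m·n ≥ 2` such that the conjugacy class map `(x, y) ↦ [x⁻¹ y]` realises `⟨l, m, n⟩` (CU13 Def. 12)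
  and `k(G) ≤ (l·m·n)^((2+ε)/3)`. It is CU13 Conj. 21 restricted to group association schemes and relaxed to
  rectangles at the cube-root exponent. WHY EASIER / what it exposes: (i) the design is three SUBSETS OF A
  GROUP and the figure of merit is the classical invariant `k(G)` (commuting probability `k(G)/|G|`,
  Gallagher-type bounds, exact counts for wreath products — CU13 Lemma 25), instead of the fusion rank of an
  S-ring, which is where `birth`/`CyclicRealization` are stuck (sum–product); (ii) OBSTRUCTION AS RESOURCE:
  BCCGU17 Prop. 2.4 (tree: `Literature.Barriers.MatrixMultiplication.BCCGU2017_prop24`) says a TPP triple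
  with `k(G)·(|S||T||U|)^(2/3) ≤ |G|` is worthless in `ℂ[G]` — FEW conjugacy classes kill the group-algebra
  route — while here few classes are precisely the goal (`k(G) ≤ (lmn)^((2+ε)/3)`), so the hosts barred for
  `ℂ[G]` by class-counting are the candidates, and conversely; (iii) finite, enumerable search space
  (SmallGroups + the two-sided TPP test) with a typed first milestone "`|A||B||C| > k(G)`" (impossible for
  abelian `G`, where the condition is the TPP and `k(G) = |G| ≥ |A||B||C|`, CU03 Lemma 3.1).
* `stub_conjugacyScheme` — the group association scheme IS a commutative association scheme in the vendored
  vocabulary (CU13 §4.2/§6.3; Bannai–Ito II.7 "group scheme"): one diagonal class (`[x⁻¹y] = [1] ↔ x = y`),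
  transpose = inversion of classes, intersection numbers `p^k_{ij} = #{(u,v) ∈ C_i × C_j : uv = w}` for
  `w ∈ C_k` (class algebra constants, independent of the representative), commutative because
  `(u, v) ↦ (v, v⁻¹uv)` is a bijection `{(u,v) ∈ C_i × C_j : uv = w} → {(v,u') ∈ C_j × C_i : vu' = w}`.
  Provable now, size M.
* `CommutativeRealization_of_stubs` — sorry-free composition with explicit hypotheses: stub 1 gives `G`, the
  shape and the realisation by the raw conjugacy class map; stub 2 turns the class map (relabelled into
  `Fin k(G)`, `Realizes.map`) into a commutative `AssociationScheme`; the LANDED tree theorem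
  `Theorems.stub_commutativeRealization_cube` (p147391, CU13 §4.2 + Thm. 17 ¶1) cubes it to a commutative scheme
  on `G × G × G` realising `⟨N,N,N⟩`, `N = lmn ≥ 2`, with `r' ≤ k(G)³ ≤ N^(2+ε)` labels; the scheme unpacks
  into the route's inlined clauses.
* `CommutativeRealization_of : CommutativeRealization` — the skeleton theorem, the crux BY NAME; `sorry` occurs
  ONLY inside the two `stub_*`.

Disproof used: none exists for this crux (`ledger crux ls stmt-MatrixMultiplication-9462`, 2026-08-17: Lines/birth.*,
PICKED.md only; no `Disproof.lean`, no `Theorems/CommutativeRealization/Negative/`); `ledger negatives --problem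
MatrixMultiplication` (9 entries, 2026-08-17) has nothing on association schemes, conjugacy classes or realisation
(nearest: `not_HyperoctahedralThreshold`, `SnThresholdCensusThresholdSubgroupTriples_refuted` — SUBGROUP TPP triples
in `S_n` priced in `ℂ[S_n]`; stub 1 prices in `k(G)` and its witnesses need not be subgroups nor live in `S_n`).
Dead zone recorded in the card (not a refutation): groups of Lie type / quasirandom groups, where products of
three non-central conjugacy classes cover `1` (class-covering results), so no two-sided TPP of size ≥ 2 per leg
survives among regular classes — the hosts must have large normal abelian sections (CU13's `S_n ⋉ H^n`).
-/

-- `Summit.<Summit>.<Problem>`: for the single-conjunct summit the duplicate component is mandated.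
set_option linter.dupNamespace false

namespace Summit.MatrixMultiplication.MatrixMultiplication.Cruxes.CommutativeRealization.Conjugacy

open Literature.Combinatorics.AssociationSchemes
open Summit.MatrixMultiplication.MatrixMultiplication.Theses.CommutativeSchemes

/-! ## The two registered stubs -/

/-- **Stub 1 — conjugacy-class designs at the cube-root exponent (OPEN; the load-bearing stub).**
For every `ε > 0` there are a finite group `G` and a shape `l·m·n ≥ 2` such that the class map of the GROUP
ASSOCIATION SCHEME of `G` — `(x, y) ↦` the conjugacy class of `x⁻¹ y` (CU13 §6.3; the Schurian scheme of
`G × G` acting on `G` by two-sided multiplication) — realises `⟨l, m, n⟩` in the sense of CU13 Def. 12, with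
`k(G) = Nat.card (ConjClasses G) ≤ (l·m·n)^((2+ε)/3)`. Equivalently (CU13 Prop. 14 for this action): subsets
`A, B, C ⊆ G` of sizes `l, m, n` with the TWO-SIDED triple product property
`(a⁻¹b')·g(b⁻¹c')g⁻¹·h(c⁻¹a')h⁻¹ = 1 ⟹ a = a' ∧ b = b' ∧ c = c'`. Why plausibly true: it is CU13 Conj. 21 on
CU13's second host family; KNOWN for `ε ≥ 0.41 + o(1)` (CU13 Thm. 24 + Lemma 25 + Cor. 26: `G = S_n ⋉ H^n` over
the CKSU05 Thm. 3.3 STPP family proves `ω_s ≤ 2.41`), and implied for every `ε` by either conjecture of CKSU05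
(CU13 §6.3 (2), `t ≥ n^ε`, `|H| = (t²n)^(1+o(1))`). Why it might fail: injectivity forces
`lm, mn, nl ≤ k(G)`, so the three difference maps `A × B → Cl(G)` must be near-bijections onto a polynomially
dense set of classes while no product of three used classes through unmatched indices contains `1`; every
instance on record is a wreath product over a bounded-exponent abelian STPP (slice-rank-barred as `ε → 0`,
BCCGNSU17), quasirandom / Lie-type `G` are excluded by class-product covering, and CKSU05 Conj. 3.4 is false
(BCCGNSU17). Size XL / open. Sources: CohnUmans2013 = arXiv:1207.6528 (§6.3, Prop. 14, Thm. 24, Lemma 25,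
Cor. 26, Conj. 21), CohnUmans2003 = arXiv:math/0307321 (Lemma 3.1, Thm. 6), CohnKleinbergSzegedyUmans2005,
BlasiakChurchCohnGrochowUmans2017 (Prop. 2.4), BlasiakChurchCohnGrochowNaslundSawinUmans2017. -/
theorem stub_conjugacyClassDesign :
    ∀ ε : ℝ, 0 < ε → ∃ (G : Type) (_ : Group G) (_ : Fintype G) (l m n : ℕ),
      2 ≤ l * m * n ∧
        (Nat.card (ConjClasses G) : ℝ) ≤ ((l * m * n : ℕ) : ℝ) ^ ((2 + ε) / 3) ∧
          Realizes (fun x y : G => ConjClasses.mk (x⁻¹ * y)) l m n := by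
  sorry

/-- **Stub 2 — the group association scheme is a commutative association scheme** (CU13 §4.2, §6.3;
Bannai–Ito, *Algebraic Combinatorics I*, §II.7 Example "group scheme"). For every finite group `G` there is a
commutative `AssociationScheme` on the point set `G`, with classes labelled by `Fin k(G)` through an injective
numbering `e` of the conjugacy classes, whose class map is `cls x y = e [x⁻¹ y]`: the diagonal is the class of
`1` and only it (`[x⁻¹y] = [1] ↔ x = y`); the transpose of a class is the inverse class; the intersection
numbers are the class algebra constants `#{(u, v) ∈ C_i × C_j : u v = w}`, `w ∈ C_k`, independent of the
representative `w` (conjugate the solutions); commutativity: `(u, v) ↦ (v, v⁻¹ u v)` matches the solutions of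
`u v = w` in `C_i × C_j` with those of `v u' = w` in `C_j × C_i`. Why plausibly true: it is a theorem. Size M
(provable now: `Finite.equivFin (ConjClasses G)` for `e`; `Finset.card_bij` twice). Sources: arXiv:1207.6528
§4.2/§6.3; Bannai–Ito 1984 §II.7. -/
theorem stub_conjugacyScheme :
    ∀ (G : Type) [Group G] [Fintype G],
      ∃ (e : ConjClasses G → Fin (Nat.card (ConjClasses G)))
        (S : AssociationScheme G (Fin (Nat.card (ConjClasses G)))),
        Function.Injective e ∧ S.IsCommutative ∧
          ∀ x y : G, S.cls x y = e (ConjClasses.mk (x⁻¹ * y)) :=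
  -- LANDED (p151206, by the lead of line `registered` servicing this alt line):
  -- Theorems/CommutativeSchemesCommutativeRealizationStubConjugacyScheme.lean
  Summit.MatrixMultiplication.MatrixMultiplication.Theorems.stub_conjugacyScheme

/-! ## Sorry-free composition -/

/-- **Composition with explicit hypotheses** (`stub₁-sig → stub₂-sig → crux`, the conclusion being the crux
statement of the route file verbatim). Given `ε > 0`: stub 1 yields `G`, a shape `l m n ≥ 2` with
`k(G) ≤ (lmn)^((2+ε)/3)` and a realisation of `⟨l,m,n⟩` by the conjugacy class map; stub 2 packages the class
map, renumbered into `Fin k(G)`, as a commutative association scheme `S` (realisation transported by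
`Realizes.map` along the injective numbering); the landed cube theorem
`Theorems.stub_commutativeRealization_cube` gives a commutative scheme `T` on `G × G × G` realising `⟨N,N,N⟩`,
`N = lmn`, with `r' ≤ k(G)³ ≤ ((lmn)^((2+ε)/3))³ = N^(2+ε)` labels; finally the scheme structure unpacks into
the route's inlined clauses (`cls_eq_cls_self_iff`, `exists_transpose`, `isCommutative_iff`, `Realizes` by
`Iff.rfl`). [cite: CohnUmans2013, §6.3] -/
theorem CommutativeRealization_of_stubs
    (hA : ∀ ε : ℝ, 0 < ε → ∃ (G : Type) (_ : Group G) (_ : Fintype G) (l m n : ℕ),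
      2 ≤ l * m * n ∧
        (Nat.card (ConjClasses G) : ℝ) ≤ ((l * m * n : ℕ) : ℝ) ^ ((2 + ε) / 3) ∧
          Realizes (fun x y : G => ConjClasses.mk (x⁻¹ * y)) l m n)
    (hB : ∀ (G : Type) [Group G] [Fintype G],
      ∃ (e : ConjClasses G → Fin (Nat.card (ConjClasses G)))
        (S : AssociationScheme G (Fin (Nat.card (ConjClasses G)))),
        Function.Injective e ∧ S.IsCommutative ∧
          ∀ x y : G, S.cls x y = e (ConjClasses.mk (x⁻¹ * y))) :
    ∀ ε : ℝ, 0 < ε → ∃ n : ℕ, 2 ≤ n ∧ ∃ (X : Type) (_ : Fintype X) (r : ℕ) (cls : X → X → Fin r),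
      (r : ℝ) ≤ (n : ℝ) ^ (2 + ε) ∧ (∀ x y z : X, cls x y = cls z z ↔ x = y) ∧
      (∃ τ : Fin r → Fin r, ∀ x y : X, cls y x = τ (cls x y)) ∧
      (∃ p : Fin r → Fin r → Fin r → ℕ, (∀ (a b : Fin r) (x y : X),
        (Finset.univ.filter (fun z : X => cls x z = a ∧ cls z y = b)).card = p a b (cls x y)) ∧
          ∀ a b c : Fin r, p a b c = p b a c) ∧
      ∃ α β γ : Fin n × Fin n → Fin r, Function.Injective α ∧ Function.Injective β ∧
        Function.Injective γ ∧ ∀ a a' b b' c c' : Fin n,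
          ((∃ x y z : X, cls x y = α (a, b') ∧ cls y z = β (b, c') ∧ cls z x = γ (c, a')) ↔
            (a = a' ∧ b = b' ∧ c = c')) := by
  intro ε hε
  obtain ⟨G, _instG, _instF, l, m, n, h2, hr, hreal⟩ := hA ε hε
  obtain ⟨e, S, he, hScomm, hcls⟩ := hB G
  -- the conjugacy class map, renumbered into `Fin k(G)`, is the class map of the scheme `S`
  have hfun : S.cls = fun x y : G => e (ConjClasses.mk (x⁻¹ * y)) :=
    funext fun x => funext fun y => hcls x y
  have hSreal : S.Realizes l m n := by
    show Realizes S.cls l m n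
    rw [hfun]
    exact Realizes.map he hreal
  -- cube it (landed theorem of line `birth`, stub 3)
  obtain ⟨r', T, hr', hTcomm, hTreal⟩ :=
    Summit.MatrixMultiplication.MatrixMultiplication.Theorems.stub_commutativeRealization_cube
      G l m n (Nat.card (ConjClasses G)) S hScomm hSreal
  refine ⟨l * m * n, h2, G × G × G, inferInstance, r', T.cls, ?_, T.cls_eq_cls_self_iff,
    T.exists_transpose, T.isCommutative_iff.1 hTcomm, hTreal⟩
  -- the count: `r' ≤ k(G)³ ≤ ((lmn)^((2+ε)/3))³ = (lmn)^(2+ε)`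
  have h0 : (0 : ℝ) ≤ ((l * m * n : ℕ) : ℝ) := Nat.cast_nonneg _
  have h1 : (r' : ℝ) ≤ (Nat.card (ConjClasses G) : ℝ) ^ (3 : ℕ) := by exact_mod_cast hr'
  have h2' : (Nat.card (ConjClasses G) : ℝ) ^ (3 : ℕ) ≤
      (((l * m * n : ℕ) : ℝ) ^ ((2 + ε) / 3)) ^ (3 : ℕ) :=
    pow_le_pow_left₀ (Nat.cast_nonneg _) hr 3
  have h3 : (((l * m * n : ℕ) : ℝ) ^ ((2 + ε) / 3)) ^ (3 : ℕ) = ((l * m * n : ℕ) : ℝ) ^ (2 + ε) := by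
    rw [← Real.rpow_natCast, ← Real.rpow_mul h0]
    congr 1
    push_cast
    ring
  calc (r' : ℝ) ≤ (Nat.card (ConjClasses G) : ℝ) ^ (3 : ℕ) := h1
    _ ≤ (((l * m * n : ℕ) : ℝ) ^ ((2 + ε) / 3)) ^ (3 : ℕ) := h2'
    _ = ((l * m * n : ℕ) : ℝ) ^ (2 + ε) := h3

/-! ## The skeleton theorem: the crux BY NAME -/

/-- **THE SKELETON THEOREM.** The crux
`Summit.MatrixMultiplication.MatrixMultiplication.Theses.CommutativeSchemes.CommutativeRealization`
(stmt-MatrixMultiplication-9462, CU13 Conjecture 21 in ε-form), concluded BY NAME from the two DECLARED stubs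
`stub_conjugacyClassDesign`, `stub_conjugacyScheme` (the only `sorry`s of the file) and the landed cube theorem,
through the sorry-free composition `CommutativeRealization_of_stubs`. [cite: CohnUmans2013, Conj. 21] -/
theorem CommutativeRealization_of :
    Summit.MatrixMultiplication.MatrixMultiplication.Theses.CommutativeSchemes.CommutativeRealization :=
  CommutativeRealization_of_stubs stub_conjugacyClassDesign stub_conjugacyScheme

end Summit.MatrixMultiplication.MatrixMultiplication.Cruxes.CommutativeRealization.Conjugacy
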